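import Literature.Probability.RandomPlanarGeometry.LSW2004USTApproxLoop
import Literature.Probability.RandomPlanarGeometry.RadoConvergenceProofs
import Literature.Probability.RandomPlanarGeometry.ConformalMapCaratheodoryProofs
import Literature.Probability.RandomPlanarGeometry.HalfPlaneAutomorphism
import Literature.Probability.RandomPlanarGeometry.JordanDomainProofs
import Literature.Probability.RandomPlanarGeometry.RestrictionHullsProofs
import HarnessLib

/-!
# [LSW04] p. 977: `R⁻¹ φ_R⁻¹ → φ⁻¹` uniformly on `ℍ̄` (via Radó's theorem), and Thm. 4.7's driving input from Thm. 4.4 alone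

G. F. Lawler, O. Schramm, W. Werner, *Conformal invariance of planar loop-erased random walks and
uniform spanning trees*, Ann. Probab. **32** (2004) 939–995 (**[LSW04]**). In the proof of
Prop. 4.5 (p. 977) LSW note: "Let `φ : D → ℍ` be the conformal homeomorphism satisfying
`φ(a) = 0`, `φ(b) = ∞` and `|φ(0)| = 1`, and let `φ_R : D^R → ℍ` be the one satisfying
`φ_R(a^R) = 0`, `φ_R(b^R) = ∞` and `|φ_R(0)| = 1`. Then `lim_{R → ∞} R⁻¹ φ_R⁻¹(z) = φ⁻¹(z)`,
where the convergence is uniform in `ℍ̄`. (This follows, e.g., from Cor. 2.4 in [Pommerenke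
1992])." This convergence is the second input `hconv` of the tree's
`USTPeano.drivingProcess_tendsto_of_thm44` (`LSW2004USTDriving.lean`: [LSW04] p. 981, "Theorem
4.4 implies that the law of `W` converges weakly to the law of `B(8t)`", proved from Thm. 4.4 as
printed plus this convergence). Here it is PROVED, so that the named fact
`USTPeano.drivingProcess_tendsto` is now reduced to [LSW04] Thm. 4.4 as printed, alone:

* `USTPeano.tendstoUniformlyOn_inv_mul` — along approximations `D^{Rₙ}` of a smooth `D` at scales
  `Rₙ → ∞`, for the normalised maps `φₙ : ℍ → D^{Rₙ}`, `φ_D : ℍ → D` (the tree's orientation):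
  `Rₙ⁻¹ φₙ → φ_D` uniformly on `ℍ`;
* `USTPeano.drivingProcess_tendsto_of_thm44'` — `(Thm. 4.4 as printed) → drivingProcess_tendsto`.

Proof of the convergence (Pommerenke's Cor. 2.4 route, with the tree's Radó theorem
`JordanDomain.rado_tendstoUniformlyOn_holds` = Pommerenke Thm. 2.11 in place of Cor. 2.4): the
rescaled domains `Rₙ⁻¹ D^{Rₙ}` carry boundary loops converging uniformly to that of `D`
(`IsApproximation.exists_jordanDomain`, `LSW2004USTApproxLoop.lean`), so the Carathéodory
extensions `Φₙ` of the Riemann maps `fₙ : 𝔻 → Rₙ⁻¹ D^{Rₙ}` normalised at `0` converge uniformly on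
`𝔻̄` to the extension `Φ` of `f : 𝔻 → D`. The normalised half-plane maps factor as
`Rₙ⁻¹ φₙ = Φₙ ∘ Tₙ` on `ℍ`, where `Tₙ = fₙ⁻¹ ∘ Rₙ⁻¹ φₙ : ℍ → 𝔻` is conformal with `Tₙ(wₙ) = 0`,
`wₙ = φₙ⁻¹(0)`, `|wₙ| = 1` — hence a Möbius map `Tₙ(z) = μₙ (z - wₙ)/(z - w̄ₙ)`, `|μₙ| = 1`
(`ConformalEquiv.exists_eqOn_mul_moebius`: Schwarz's lemma through the tree's
`exists_eqOn_mul_of_apply_zero`; the elementary Möbius inequalities reuse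
`HalfPlanePick.sub_conj_ne_zero` of `RestrictionHullsProofs.lean`). The boundary normalisations `φₙ → aₙ` at `0`, `φₙ → bₙ` at `∞`
give `Φₙ(μₙ wₙ/w̄ₙ) = Rₙ⁻¹ aₙ`, `Φₙ(μₙ) = Rₙ⁻¹ bₙ`, and `|aₙ - Rₙ a| ≤ 12`, `|bₙ - Rₙ b| ≤ 12`; with
`Φ(μ w/w̄) = a`, `Φ(μ) = b` for the limit and the injectivity of `Φ` on `𝔻̄` this forces `μₙ → μ`,
`wₙ² → w²`, `wₙ → w`, so `Tₙ → T` uniformly on `ℍ` (`tendstoUniformlyOn_mul_moebius`, an explicit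
estimate), and `Φₙ ∘ Tₙ → Φ ∘ T = φ_D` uniformly on `ℍ` by the uniform continuity of `Φ` on `𝔻̄`.

No definitions, no named facts: theorems only.

## References

* [LSW04] §4.3, p. 977; Thm. 4.4, p. 976; proof of Thms. 4.7/4.8, p. 981
  [LawlerSchrammWerner2004].
* Ch. Pommerenke, *Boundary Behaviour of Conformal Maps* (1992), Cor. 2.4, Thm. 2.11
  [PommerenkeBBCM1992].
* L. V. Ahlfors, *Complex Analysis* (1979), Ch. 4 §3.4 (Schwarz's lemma; maps of `ℍ` onto `𝔻`).
-/

noncomputable section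

open Set Function Filter Metric Complex MeasureTheory
open _root_.Topology
open scoped NNReal ENNReal Real

namespace Literature.Probability.RandomPlanarGeometry

/-! ### Conformal maps of the half-plane onto the disc -/

section Moebius

open UpperHalfPlane (upperHalfPlaneSet)
open scoped ComplexConjugate

/-- For `w = x + iy` (`y ≠ 0`): `C((z - x)/y) = (z - w)/(z - w̄)`, `C` the Cayley map
`u ↦ (u - i)/(u + i)` (both sides are `0` at the pole `z = w̄`, by the junk value of division).
[folklore] -/
theorem cayleyFun_inv_im_smul {w : ℂ} (hw : w.im ≠ 0) (z : ℂ) :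
    cayleyFun (w.im⁻¹ • (z + ((-w.re : ℝ) : ℂ))) = (z - w) / (z - conj w) := by
  have hy : (w.im : ℂ) ≠ 0 := by exact_mod_cast hw
  have hw' : w = (w.re : ℂ) + (w.im : ℂ) * I := (Complex.re_add_im w).symm
  have hcw : conj w = (w.re : ℂ) - (w.im : ℂ) * I := by
    apply Complex.ext <;> simp
  have h1 : w.im⁻¹ • (z + ((-w.re : ℝ) : ℂ)) - I = (w.im : ℂ)⁻¹ * (z - w) := by
    rw [Complex.real_smul]
    have e : (w.im : ℂ)⁻¹ * (z - w) = (w.im : ℂ)⁻¹ * (z - ((w.re : ℂ) + (w.im : ℂ) * I)) := by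
      rw [Complex.re_add_im]
    rw [e]
    push_cast
    field_simp
    ring
  have h2 : w.im⁻¹ • (z + ((-w.re : ℝ) : ℂ)) + I = (w.im : ℂ)⁻¹ * (z - conj w) := by
    rw [Complex.real_smul, hcw]
    push_cast
    field_simp
    ring
  rw [cayleyFun_apply, h1, h2, mul_div_mul_left _ _ (inv_ne_zero hy)]

/-- `|z - w| ≤ |z - w̄|` for `z, w` in the closed upper half-plane, so `|(z - w)/(z - w̄)| ≤ 1`.
[folklore] -/
theorem norm_sub_div_sub_conj_le_one {w z : ℂ} (hw : 0 < w.im) (hz : 0 ≤ z.im) :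
    ‖(z - w) / (z - conj w)‖ ≤ 1 := by
  have hne := HalfPlanePick.sub_conj_ne_zero hw hz
  rw [norm_div, div_le_one (norm_pos_iff.2 hne)]
  have h1 : ‖z - w‖ ^ 2 ≤ ‖z - conj w‖ ^ 2 := by
    rw [Complex.sq_norm, Complex.sq_norm, Complex.normSq_apply, Complex.normSq_apply]
    simp only [sub_re, sub_im, Complex.conj_re, Complex.conj_im]
    nlinarith
  exact (pow_le_pow_iff_left₀ (norm_nonneg _) (norm_nonneg _) two_ne_zero).1 h1

/-- `Im w ≤ |z - w̄|` for `z` in the closed upper half-plane. [folklore] -/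
theorem im_le_norm_sub_conj {w z : ℂ} (hz : 0 ≤ z.im) : w.im ≤ ‖z - conj w‖ := by
  calc w.im ≤ z.im + w.im := by linarith
    _ = (z - conj w).im := by simp
    _ ≤ |(z - conj w).im| := le_abs_self _
    _ ≤ ‖z - conj w‖ := Complex.abs_im_le_norm _

/-- **A conformal map of `ℍ` onto `𝔻` sending `w ↦ 0` is `z ↦ μ (z - w)/(z - w̄)` with
`|μ| = 1`**: compose with the inverse of `z ↦ (z - w)/(z - w̄) = C((z - Re w)/Im w)` (a conformal
map `ℍ → 𝔻` with `w ↦ 0`, built from the tree's translation, dilation and Cayley equivalences)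
to get an automorphism of `𝔻` fixing `0`, a rotation by `exists_eqOn_mul_of_apply_zero`
(Schwarz). Ahlfors (1979), Ch. 4 §3.4. [folklore] -/
theorem ConformalEquiv.exists_eqOn_mul_moebius (S : ConformalEquiv upperHalfPlaneSet (ball (0 : ℂ) 1))
    {w : ℂ} (hw : w ∈ upperHalfPlaneSet) (hSw : S w = 0) :
    ∃ μ : ℂ, ‖μ‖ = 1 ∧ EqOn S (fun z ↦ μ * ((z - w) / (z - conj w))) upperHalfPlaneSet := by
  have hy : 0 < w.im := hw
  set N : ConformalEquiv upperHalfPlaneSet (ball (0 : ℂ) 1) :=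
    ((addRealUpperHalfPlane (-w.re)).trans (smulUpperHalfPlane w.im⁻¹ (inv_pos.2 hy))).trans cayley
    with hN
  have hNapply : ∀ z ∈ upperHalfPlaneSet, N z = (z - w) / (z - conj w) := fun z hz ↦ by
    rw [hN, ConformalEquiv.trans_apply, ConformalEquiv.trans_apply, addRealUpperHalfPlane_apply,
      smulUpperHalfPlane_apply, cayley_apply]
    exact cayleyFun_inv_im_smul hy.ne' z
  have hNw : N w = 0 := by rw [hNapply w hw, sub_self, zero_div]
  set A : ConformalEquiv (ball (0 : ℂ) 1) (ball 0 1) := N.symm.trans S with hA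
  have hN0 : N.symm 0 = w := by
    have := N.symm_apply_apply hw
    rwa [hNw] at this
  have hA0 : A 0 = 0 := by
    rw [hA, ConformalEquiv.trans_apply, hN0, hSw]
  obtain ⟨μ, hμ, hAμ⟩ := A.exists_eqOn_mul_of_apply_zero hA0
  refine ⟨μ, hμ, fun z hz ↦ ?_⟩
  have hNz : N z ∈ ball (0 : ℂ) 1 := N.mapsTo hz
  have h1 : A (N z) = S z := by
    rw [hA, ConformalEquiv.trans_apply, N.symm_apply_apply hz]
  rw [← h1, hAμ hNz, hNapply z hz]

/-- **Uniform convergence of the maps `z ↦ μ (z - w)/(z - w̄)` on `ℍ`** as `w_n → w ∈ ℍ`,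
`μ_n → μ` (`|μ_n| ≤ 1`): with `A = z - w̄`, `A_n = z - w̄_n`, `c = w - w̄`,
`(z - w)/(z - w̄) - (z - w_n)/(z - w̄_n) = c (A_n - A)/(A A_n) + (c - c_n)/A_n`, and `|A| ≥ Im w`,
`|A_n| ≥ Im w_n`, `|A_n - A| = |c - c_n|/… ≤ 2 |w - w_n|`. [folklore] -/
theorem tendstoUniformlyOn_mul_moebius {w : ℕ → ℂ} {wl : ℂ} {μ : ℕ → ℂ} {μl : ℂ}
    (hwl : 0 < wl.im) (hw : Tendsto w atTop (𝓝 wl)) (hμ : Tendsto μ atTop (𝓝 μl))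
    (hμ1 : ∀ n, ‖μ n‖ ≤ 1) :
    TendstoUniformlyOn (fun n z ↦ μ n * ((z - w n) / (z - conj (w n))))
      (fun z ↦ μl * ((z - wl) / (z - conj wl))) atTop upperHalfPlaneSet := by
  rw [Metric.tendstoUniformlyOn_iff]
  intro ε hε
  have hs : 0 < wl.im / 2 := by linarith
  -- eventually `Im w_n ≥ Im w / 2`, `|w_n - w| < δ`, `|μ_n - μ| < ε/2`
  set δ : ℝ := min (wl.im / 2) (ε * wl.im / 32) with hδ
  have hδpos : 0 < δ := lt_min hs (by positivity)
  have hwev : ∀ᶠ n in atTop, dist (w n) wl < δ := Metric.tendsto_nhds.1 hw δ hδpos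
  have hμev : ∀ᶠ n in atTop, dist (μ n) μl < ε / 2 := Metric.tendsto_nhds.1 hμ _ (half_pos hε)
  filter_upwards [hwev, hμev] with n hwn hμn z hz
  have hz0 : 0 ≤ z.im := le_of_lt hz
  have hdw : ‖w n - wl‖ < δ := by rwa [← dist_eq_norm]
  have hδs : δ ≤ wl.im / 2 := min_le_left _ _
  have hδε : δ ≤ ε * wl.im / 32 := min_le_right _ _
  -- `Im w_n ≥ Im w / 2`
  have hwn_im : wl.im / 2 ≤ (w n).im := by
    have : |(w n - wl).im| ≤ ‖w n - wl‖ := Complex.abs_im_le_norm _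
    rw [Complex.sub_im, abs_le] at this
    linarith [this.1]
  have hwn_pos : 0 < (w n).im := by linarith
  set A : ℂ := z - conj wl with hA
  set An : ℂ := z - conj (w n) with hAn
  have hA0 : A ≠ 0 := HalfPlanePick.sub_conj_ne_zero hwl hz0
  have hAn0 : An ≠ 0 := HalfPlanePick.sub_conj_ne_zero hwn_pos hz0
  have hAge : wl.im ≤ ‖A‖ := im_le_norm_sub_conj hz0
  have hAnge : wl.im / 2 ≤ ‖An‖ := hwn_im.trans (im_le_norm_sub_conj hz0)
  -- the algebraic identity
  set c : ℂ := wl - conj wl with hc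
  set cn : ℂ := w n - conj (w n) with hcn
  have hid : (z - w n) / An - (z - wl) / A = c * (An - A) / (A * An) + (c - cn) / An := by
    have h1 : z - conj wl ≠ 0 := hA0
    have h2 : z - conj (w n) ≠ 0 := hAn0
    simp only [hc, hcn, hA, hAn]
    field_simp
    ring
  have hcnorm : ‖c‖ ≤ 2 * ‖A‖ := by
    have hc' : c = ((2 * wl.im : ℝ) : ℂ) * I := by
      apply Complex.ext
      · simp [hc]
      · simp [hc]; ring
    have : ‖c‖ = 2 * wl.im := by
      rw [hc', norm_mul, Complex.norm_I, mul_one, Complex.norm_real, Real.norm_of_nonneg (by linarith)]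
    rw [this]; linarith
  have hAnA : ‖An - A‖ = ‖w n - wl‖ := by
    rw [hAn, hA, show z - conj (w n) - (z - conj wl) = conj wl - conj (w n) by ring,
      ← map_sub, Complex.norm_conj, norm_sub_rev]
  have hccn : ‖c - cn‖ ≤ 2 * ‖w n - wl‖ := by
    rw [hc, hcn, show wl - conj wl - (w n - conj (w n)) = (wl - w n) - (conj wl - conj (w n)) by ring,
      ← map_sub]
    calc ‖wl - w n - conj (wl - w n)‖ ≤ ‖wl - w n‖ + ‖conj (wl - w n)‖ := norm_sub_le _ _
      _ = 2 * ‖w n - wl‖ := by rw [Complex.norm_conj, norm_sub_rev]; ring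
  -- the estimate of the Möbius part
  have hmoeb : ‖(z - wl) / A - (z - w n) / An‖ ≤ 8 * ‖w n - wl‖ / wl.im := by
    rw [norm_sub_rev, hid]
    have hApos : 0 < ‖A‖ := lt_of_lt_of_le hwl hAge
    have hAnpos : 0 < ‖An‖ := lt_of_lt_of_le hs hAnge
    calc ‖c * (An - A) / (A * An) + (c - cn) / An‖
        ≤ ‖c * (An - A) / (A * An)‖ + ‖(c - cn) / An‖ := norm_add_le _ _
      _ = ‖c‖ * ‖An - A‖ / (‖A‖ * ‖An‖) + ‖c - cn‖ / ‖An‖ := by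
          rw [norm_div, norm_div, norm_mul, norm_mul]
      _ ≤ (2 * ‖A‖) * ‖w n - wl‖ / (‖A‖ * ‖An‖) + 2 * ‖w n - wl‖ / ‖An‖ := by
          rw [hAnA]
          gcongr
      _ = 4 * ‖w n - wl‖ / ‖An‖ := by
          field_simp
          ring
      _ ≤ 4 * ‖w n - wl‖ / (wl.im / 2) := by
          apply div_le_div_of_nonneg_left (by positivity) hs hAnge
      _ = 8 * ‖w n - wl‖ / wl.im := by
          field_simp
          ring
  -- assemble
  have hfrac_le : ‖(z - w n) / An‖ ≤ 1 := norm_sub_div_sub_conj_le_one hwn_pos hz0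
  have hμl1 : ‖μl‖ ≤ 1 := le_of_tendsto' hμ.norm hμ1
  rw [dist_eq_norm,
    show μl * ((z - wl) / A) - μ n * ((z - w n) / An) =
      μl * ((z - wl) / A - (z - w n) / An) + (μl - μ n) * ((z - w n) / An) by ring]
  have t1 : ‖μl * ((z - wl) / A - (z - w n) / An)‖ ≤ 8 * ‖w n - wl‖ / wl.im := by
    rw [norm_mul]
    calc ‖μl‖ * ‖(z - wl) / A - (z - w n) / An‖ ≤ 1 * (8 * ‖w n - wl‖ / wl.im) :=
          mul_le_mul hμl1 hmoeb (norm_nonneg _) zero_le_one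
      _ = _ := one_mul _
  have t2 : ‖(μl - μ n) * ((z - w n) / An)‖ ≤ ‖μl - μ n‖ := by
    rw [norm_mul]
    calc ‖μl - μ n‖ * ‖(z - w n) / An‖ ≤ ‖μl - μ n‖ * 1 :=
          mul_le_mul_of_nonneg_left hfrac_le (norm_nonneg _)
      _ = _ := mul_one _
  have h1 : 8 * ‖w n - wl‖ / wl.im < ε / 2 := by
    rw [div_lt_iff₀ hwl]
    linarith
  have h2 : ‖μl - μ n‖ < ε / 2 := by rwa [← dist_eq_norm, dist_comm]
  calc ‖μl * ((z - wl) / A - (z - w n) / An) + (μl - μ n) * ((z - w n) / An)‖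
      ≤ ‖μl * ((z - wl) / A - (z - w n) / An)‖ + ‖(μl - μ n) * ((z - w n) / An)‖ := norm_add_le _ _
    _ < ε := by linarith

end Moebius

/-! ### [LSW04] p. 977: `R⁻¹ φ_R⁻¹ → φ⁻¹` uniformly on `ℍ̄` -/

namespace USTPeano

open UpperHalfPlane (upperHalfPlaneSet)
open scoped ComplexConjugate PathBorel

section Convergence

variable (D : SmoothDomain) (R : ℕ → ℝ) (Δ : ℕ → Domain)

/-- `w / w̄ = w²` on the unit circle. [folklore] -/
theorem div_conj_eq_sq {w : ℂ} (hw : ‖w‖ = 1) : w / conj w = w ^ 2 := by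
  have h1 : w * conj w = 1 := by
    rw [Complex.mul_conj, Complex.normSq_eq_norm_sq, hw]
    simp
  have h2 : conj w = w⁻¹ := (eq_inv_of_mul_eq_one_right h1)
  rw [h2, div_inv_eq_mul, sq]

/-- `‖w / w̄‖ = 1` on the unit circle. [folklore] -/
theorem norm_div_conj {w : ℂ} (hw : ‖w‖ = 1) : ‖w / conj w‖ = 1 := by
  rw [norm_div, Complex.norm_conj, hw, div_one]

/-- The Möbius map `z ↦ m (z - v)/(z - v̄)` tends to `m v/v̄` at `0` within `ℍ`. [folklore] -/
theorem tendsto_mul_moebius_nhdsWithin_zero {v : ℂ} (hv : v ∈ upperHalfPlaneSet) (m : ℂ) :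
    Tendsto (fun z ↦ m * ((z - v) / (z - conj v))) (𝓝[upperHalfPlaneSet] 0)
      (𝓝 (m * (v / conj v))) := by
  have hcv : (0 : ℂ) - conj v ≠ 0 := HalfPlanePick.sub_conj_ne_zero hv (by simp)
  have hcont : ContinuousAt (fun z : ℂ ↦ m * ((z - v) / (z - conj v))) 0 :=
    continuousAt_const.mul
      ((continuousAt_id.sub continuousAt_const).div (continuousAt_id.sub continuousAt_const) hcv)
  have := hcont.tendsto
  simp only [zero_sub, neg_div_neg_eq] at this
  exact this.mono_left nhdsWithin_le_nhds

/-- The Möbius map `z ↦ m (z - v)/(z - v̄)` tends to `m` at `∞` within `ℍ`. [folklore] -/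
theorem tendsto_mul_moebius_cocompact {v : ℂ} (hv : v ∈ upperHalfPlaneSet) (m : ℂ) :
    Tendsto (fun z ↦ m * ((z - v) / (z - conj v))) (cocompact ℂ ⊓ 𝓟 upperHalfPlaneSet) (𝓝 m) := by
  -- `(z - v̄)⁻¹ → 0` at `∞`
  have h1 : Tendsto (fun z : ℂ ↦ ‖z - conj v‖) (cocompact ℂ) atTop := by
    refine tendsto_atTop_mono (fun z ↦ norm_sub_norm_le z (conj v)) ?_
    exact tendsto_atTop_add_const_right _ _ tendsto_norm_cocompact_atTop
  have h2 : Tendsto (fun z : ℂ ↦ (z - conj v)⁻¹) (cocompact ℂ) (𝓝 0) := by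
    rw [tendsto_zero_iff_norm_tendsto_zero]
    simp only [norm_inv]
    exact tendsto_inv_atTop_zero.comp h1
  -- `m (z - v)/(z - v̄) = m (1 + (v̄ - v)(z - v̄)⁻¹)` on `ℍ`
  have h3 : Tendsto (fun z : ℂ ↦ m * (1 + (conj v - v) * (z - conj v)⁻¹)) (cocompact ℂ)
      (𝓝 (m * (1 + (conj v - v) * 0))) :=
    tendsto_const_nhds.mul (tendsto_const_nhds.add (tendsto_const_nhds.mul h2))
  rw [mul_zero, add_zero, mul_one] at h3
  refine (h3.mono_left inf_le_left).congr' ?_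
  refine eventually_inf_principal.2 (Eventually.of_forall fun z hz ↦ ?_)
  have hne : z - conj v ≠ 0 := HalfPlanePick.sub_conj_ne_zero hv (le_of_lt hz)
  field_simp
  ring

/-- **[LSW04] p. 977: "`lim_{R → ∞} R⁻¹ φ_R⁻¹(z) = φ⁻¹(z)`, where the convergence is uniform in
`ℍ̄`"** — for the normalised maps `φ_R` of the approximations `D^R` at scales `Rₙ` (here all
scales large: `Rₙ |a - b| > 22`) and `φ` of `D` (the tree's maps go `ℍ → D^R`, `ℍ → D`, so this
reads `Rₙ⁻¹ φₙ → φ_D` uniformly on `ℍ`). Proof ("this follows, e.g., from Cor. 2.4 in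
[Pommerenke 1992]"): by `IsApproximation.exists_jordanDomain` the rescaled domains `Rₙ⁻¹ D^{Rₙ}`
carry boundary loops converging uniformly to that of `D`, so by Radó's theorem
(`JordanDomain.rado_tendstoUniformlyOn_holds`, closed-disc form) the Carathéodory extensions `Φₙ` of
the Riemann maps `fₙ : 𝔻 → Rₙ⁻¹ D^{Rₙ}` normalised at `0` converge uniformly on `𝔻̄` to that of
`f : 𝔻 → D`. The normalised half-plane maps factor as `Rₙ⁻¹ φₙ = Φₙ ∘ Tₙ` with
`Tₙ = fₙ⁻¹ ∘ Rₙ⁻¹ φₙ : ℍ → 𝔻` conformal, `Tₙ(wₙ) = 0` for `wₙ = φₙ⁻¹(0)`, `|wₙ| = 1`, hence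
`Tₙ(z) = μₙ (z - wₙ)/(z - w̄ₙ)`, `|μₙ| = 1` (`ConformalEquiv.exists_eqOn_mul_moebius`); the boundary
values `φₙ → aₙ` at `0`, `→ bₙ` at `∞` give `Φₙ(μₙ wₙ/w̄ₙ) = Rₙ⁻¹ aₙ → a = Φ(μ w/w̄)` and
`Φₙ(μₙ) = Rₙ⁻¹ bₙ → b = Φ(μ)` (`|aₙ - Rₙ a| ≤ 12`), whence `μₙ → μ`, `wₙ² → w²`, `wₙ → w` (injectivity of
`Φ` on `𝔻̄`, compactness), `Tₙ → T` uniformly on `ℍ` (`tendstoUniformlyOn_mul_moebius`), and finally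
`Φₙ ∘ Tₙ → Φ ∘ T = φ_D` uniformly on `ℍ` by the uniform continuity of `Φ` on `𝔻̄`.
[cite: LawlerSchrammWerner2004, §4.3] -/
theorem tendstoUniformlyOn_inv_mul_of_forall (hR : Tendsto R atTop atTop)
    (hΔ : ∀ n, IsApproximation D (R n) (Δ n))
    (hRn : ∀ n, 22 < R n * dist (D.toMarkedDomain.pt 0) (D.toMarkedDomain.pt 1))
    (φD : ConformalEquiv upperHalfPlaneSet D.toMarkedDomain.carrier)
    (hφD : D.toMarkedDomain.IsChordalUniformizing φD) (hφD1 : ‖φD.symm 0‖ = 1)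
    (φ : ∀ n, ConformalEquiv upperHalfPlaneSet (Δ n).carrier) (hφ : ∀ n, (Δ n).IsLSWMap (φ n)) :
    TendstoUniformlyOn (fun n z ↦ ((R n : ℂ))⁻¹ * φ n z) φD atTop upperHalfPlaneSet := by
  classical
  -- positivity of the scales
  have hab : 0 < dist (D.toMarkedDomain.pt 0) (D.toMarkedDomain.pt 1) :=
    dist_pos.2 fun heq ↦ by simpa using D.toMarkedDomain.pt_injective heq
  have hRpos : ∀ n, 0 < R n := fun n ↦ by
    by_contra hle
    have := mul_nonpos_of_nonpos_of_nonneg (not_lt.1 hle) hab.le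
    linarith [hRn n]
  have hcR : ∀ n, ((R n : ℂ))⁻¹ = (((R n)⁻¹ : ℝ) : ℂ) := fun n ↦ by simp
  have hcn0 : ∀ n, ((R n : ℂ))⁻¹ ≠ 0 := fun n ↦ inv_ne_zero (by exact_mod_cast (hRpos n).ne')
  -- the rescaled Jordan domains and the convergence of their boundary loops
  choose E hEc hEb using fun n ↦ (hΔ n).exists_jordanDomain (hRn n)
  have hJ : TendstoUniformly (fun n ↦ (E n).boundary) D.toMarkedDomain.toJordanDomain.boundary atTop := by
    rw [Metric.tendstoUniformly_iff]
    intro ε hε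
    have h1 : Tendsto (fun n ↦ 14 / R n) atTop (𝓝 0) := tendsto_const_nhds.div_atTop hR
    filter_upwards [(tendsto_order.1 h1).2 ε hε] with n hn t
    rw [dist_comm]
    exact (hEb n t).trans_lt hn
  -- base points
  have h0D : (0 : ℂ) ∈ D.toMarkedDomain.toJordanDomain.carrier := D.zero_mem
  have h0Δ : ∀ n, (0 : ℂ) ∈ (Δ n).carrier := fun n ↦ (hΔ n).2.2
  have h0E : ∀ n, (0 : ℂ) ∈ (E n).carrier := fun n ↦ by
    rw [hEc n]; exact ⟨0, h0Δ n, by simp⟩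
  have hb0 : (0 : ℂ) ∈ ball (0 : ℂ) 1 := mem_ball_self one_pos
  -- normalised Riemann maps and their inverses
  obtain ⟨ψl, hψl0, hψlre, hψlim⟩ := exists_conformalEquiv_ball_deriv_pos D.toMarkedDomain.toJordanDomain.isOpen
    (JordanDomain.isSimplyConnected_holds D.toMarkedDomain.toJordanDomain) D.toMarkedDomain.toJordanDomain.carrier_ne_univ h0D
  choose ψ hψ0 hψre hψim using fun n ↦ exists_conformalEquiv_ball_deriv_pos (E n).isOpen
    (JordanDomain.isSimplyConnected_holds (E n)) (E n).carrier_ne_univ (h0E n)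
  set f : ∀ n, ConformalEquiv (ball (0 : ℂ) 1) (E n).carrier := fun n ↦ (ψ n).symm with hf
  set fl : ConformalEquiv (ball (0 : ℂ) 1) D.toMarkedDomain.toJordanDomain.carrier := ψl.symm
    with hfl
  have hfl0 : fl 0 = 0 := by
    have := ψl.symm_apply_apply h0D
    rwa [hψl0] at this
  have hf0' : ∀ n, f n 0 = 0 := fun n ↦ by
    have := (ψ n).symm_apply_apply (h0E n)
    rwa [hψ0 n] at this
  have hf0 : ∀ n, f n 0 = fl 0 := fun n ↦ by rw [hf0' n, hfl0]
  have hfd : ∀ n, 0 < (deriv (f n) 0).re ∧ (deriv (f n) 0).im = 0 := fun n ↦ by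
    have h := (ψ n).deriv_symm_mul_deriv (E n).isOpen (h0E n)
    rw [hψ0 n] at h
    exact Rado.re_pos_im_zero_of_mul_eq_one (hψre n) (hψim n) h
  have hfld : 0 < (deriv fl 0).re ∧ (deriv fl 0).im = 0 := by
    have h := ψl.deriv_symm_mul_deriv D.toMarkedDomain.toJordanDomain.isOpen h0D
    rw [hψl0] at h
    exact Rado.re_pos_im_zero_of_mul_eq_one hψlre hψlim h
  -- Radó's theorem for the Carathéodory extensions
  choose Φ hΦc hΦeq hΦbij hΦsph using fun n ↦ JordanDomain.exists_continuousOn_extension_holds (E n) (f n)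
  obtain ⟨Φl, hΦlc, hΦleq, hΦlbij, hΦlsph⟩ := JordanDomain.exists_continuousOn_extension_holds D.toMarkedDomain.toJordanDomain fl
  have hrado : TendstoUniformlyOn Φ Φl atTop (closedBall (0 : ℂ) 1) :=
    JordanDomain.rado_tendstoUniformlyOn.closedBall JordanDomain.rado_tendstoUniformlyOn_holds E
      D.toMarkedDomain.toJordanDomain
      f fl hf0 hfd hfld hJ Φ Φl hΦc hΦeq hΦlc hΦleq
  -- the conformal maps `Sₙ = ψₙ ∘ (Rₙ⁻¹ φₙ) : ℍ → 𝔻`, `S = ψ ∘ φ_D`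
  have hcφ : ∀ n, ∀ z ∈ upperHalfPlaneSet, ((R n : ℂ))⁻¹ * φ n z ∈ (E n).carrier := fun n z hz ↦ by
    rw [hEc n, hcR n]; exact ⟨φ n z, (φ n).mapsTo hz, rfl⟩
  have hS : ∀ n, ∃ S : ConformalEquiv upperHalfPlaneSet (ball (0 : ℂ) 1),
      ∀ z, S z = ψ n (((R n : ℂ))⁻¹ * φ n z) := by
    intro n
    let M : ConformalEquiv (Δ n).carrier (E n).carrier :=
      { toFun := fun z ↦ ((R n : ℂ))⁻¹ * z
        invFun := fun z ↦ (R n : ℂ) * z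
        source := (Δ n).carrier
        target := (E n).carrier
        map_source' := fun z hz ↦ by rw [hEc n, hcR n]; exact ⟨z, hz, rfl⟩
        map_target' := fun y hy ↦ by
          rw [hEc n] at hy
          obtain ⟨z, hz, rfl⟩ := hy
          show (R n : ℂ) * ((((R n)⁻¹ : ℝ) : ℂ) * z) ∈ (Δ n).carrier
          rwa [← hcR n, mul_inv_cancel_left₀ (by exact_mod_cast (hRpos n).ne')]
        left_inv' := fun z _ ↦ mul_inv_cancel_left₀ (by exact_mod_cast (hRpos n).ne') z
        right_inv' := fun y _ ↦ by
          show ((R n : ℂ))⁻¹ * ((R n : ℂ) * y) = y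
          rw [inv_mul_cancel_left₀ (by exact_mod_cast (hRpos n).ne')]
        source_eq := rfl
        target_eq := rfl
        differentiableOn := differentiableOn_id.const_mul _
        differentiableOn_symm := differentiableOn_id.const_mul _ }
    exact ⟨((φ n).trans M).trans (ψ n), fun z ↦ rfl⟩
  choose S hSapply using hS
  set Sl : ConformalEquiv upperHalfPlaneSet (ball (0 : ℂ) 1) := φD.trans ψl with hSl
  -- the LSW normalisation: `Sₙ(wₙ) = 0`, `wₙ = φₙ⁻¹(0)`, `|wₙ| = 1`
  set w : ℕ → ℂ := fun n ↦ (φ n).symm 0 with hw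
  set wl : ℂ := φD.symm 0 with hwl
  have hwmem : ∀ n, w n ∈ upperHalfPlaneSet := fun n ↦ (φ n).symm_mapsTo (h0Δ n)
  have hwlmem : wl ∈ upperHalfPlaneSet := φD.symm_mapsTo h0D
  have hwnorm : ∀ n, ‖w n‖ = 1 := fun n ↦ (hφ n).2
  have hSw : ∀ n, S n (w n) = 0 := fun n ↦ by
    rw [hSapply n, show φ n (w n) = 0 from (φ n).apply_symm_apply (h0Δ n), mul_zero, hψ0 n]
  have hSlw : Sl wl = 0 := by
    rw [hSl, ConformalEquiv.trans_apply, show φD wl = 0 from φD.apply_symm_apply h0D, hψl0]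
  choose μ hμ1 hSμ using fun n ↦ (S n).exists_eqOn_mul_moebius (hwmem n) (hSw n)
  obtain ⟨μl, hμl1, hSlμ⟩ := Sl.exists_eqOn_mul_moebius hwlmem hSlw
  -- the factorisations `Rₙ⁻¹ φₙ = Φₙ ∘ Sₙ`, `φ_D = Φ ∘ S` on `ℍ`
  have hkey : ∀ n, ∀ z ∈ upperHalfPlaneSet, ((R n : ℂ))⁻¹ * φ n z = Φ n (S n z) := fun n z hz ↦ by
    have hmem : S n z ∈ ball (0 : ℂ) 1 := (S n).mapsTo hz
    rw [hΦeq n hmem, hSapply n z]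
    exact ((ψ n).symm_apply_apply (hcφ n z hz)).symm
  have hkeyl : ∀ z ∈ upperHalfPlaneSet, φD z = Φl (Sl z) := fun z hz ↦ by
    have hmem : Sl z ∈ ball (0 : ℂ) 1 := Sl.mapsTo hz
    rw [hΦleq hmem, hSl, ConformalEquiv.trans_apply]
    exact (ψl.symm_apply_apply (φD.mapsTo hz)).symm
  -- the boundary points `ζₙ = μₙ wₙ/w̄ₙ` (image of `0`) and `μₙ` (image of `∞`)
  haveI : NeBot (𝓝[upperHalfPlaneSet] (0 : ℂ)) := neBot_nhdsWithin_upperHalfPlaneSet_zero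
  haveI : NeBot (cocompact ℂ ⊓ 𝓟 upperHalfPlaneSet) := neBot_cocompact_inf_principal_upperHalfPlaneSet
  set ζ : ℕ → ℂ := fun n ↦ μ n * (w n / conj (w n)) with hζ
  set ζl : ℂ := μl * (wl / conj wl) with hζl
  have hζmem : ∀ n, ζ n ∈ closedBall (0 : ℂ) 1 := fun n ↦ by
    rw [mem_closedBall_zero_iff, hζ]
    simp only [norm_mul, hμ1 n, norm_div_conj (hwnorm n), mul_one, le_refl]
  have hwlnorm : ‖wl‖ = 1 := hφD1
  have hζlmem : ζl ∈ closedBall (0 : ℂ) 1 := by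
    rw [mem_closedBall_zero_iff, hζl, norm_mul, hμl1, norm_div_conj hwlnorm, mul_one]
  have hμmem : ∀ n, μ n ∈ closedBall (0 : ℂ) 1 := fun n ↦ by
    rw [mem_closedBall_zero_iff, hμ1 n]
  have hμlmem : μl ∈ closedBall (0 : ℂ) 1 := by rw [mem_closedBall_zero_iff, hμl1]
  -- boundary values through the factorisation
  have hbv0 : ∀ {n : ℕ} {p : ℂ}, Tendsto (φ n) (𝓝[upperHalfPlaneSet] 0) (𝓝 p) →
      Φ n (ζ n) = ((R n : ℂ))⁻¹ * p := by
    intro n p hp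
    have h1 : Tendsto (fun z ↦ ((R n : ℂ))⁻¹ * φ n z) (𝓝[upperHalfPlaneSet] 0)
        (𝓝 (((R n : ℂ))⁻¹ * p)) := hp.const_mul _
    have hS' : Tendsto (S n) (𝓝[upperHalfPlaneSet] 0) (𝓝[closedBall 0 1] (ζ n)) := by
      refine tendsto_nhdsWithin_iff.2 ⟨?_, ?_⟩
      · exact (tendsto_mul_moebius_nhdsWithin_zero (hwmem n) (μ n)).congr'
          (eventually_nhdsWithin_of_forall fun z hz ↦ (hSμ n hz).symm)
      · exact eventually_nhdsWithin_of_forall fun z hz ↦ ball_subset_closedBall ((S n).mapsTo hz)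
    have h2 : Tendsto (fun z ↦ ((R n : ℂ))⁻¹ * φ n z) (𝓝[upperHalfPlaneSet] 0) (𝓝 (Φ n (ζ n))) :=
      (((hΦc n) (ζ n) (hζmem n)).tendsto.comp hS').congr'
        (eventually_nhdsWithin_of_forall fun z hz ↦ (hkey n z hz).symm)
    exact tendsto_nhds_unique h2 h1
  have hbvinf : ∀ {n : ℕ} {p : ℂ}, Tendsto (φ n) (cocompact ℂ ⊓ 𝓟 upperHalfPlaneSet) (𝓝 p) →
      Φ n (μ n) = ((R n : ℂ))⁻¹ * p := by
    intro n p hp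
    have h1 : Tendsto (fun z ↦ ((R n : ℂ))⁻¹ * φ n z) (cocompact ℂ ⊓ 𝓟 upperHalfPlaneSet)
        (𝓝 (((R n : ℂ))⁻¹ * p)) := hp.const_mul _
    have hS' : Tendsto (S n) (cocompact ℂ ⊓ 𝓟 upperHalfPlaneSet) (𝓝[closedBall 0 1] (μ n)) := by
      refine tendsto_nhdsWithin_iff.2 ⟨?_, ?_⟩
      · exact (tendsto_mul_moebius_cocompact (hwmem n) (μ n)).congr'
          (eventually_inf_principal.2 (Eventually.of_forall fun z hz ↦ (hSμ n hz).symm))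
      · exact eventually_inf_principal.2
          (Eventually.of_forall fun z hz ↦ ball_subset_closedBall ((S n).mapsTo hz))
    have h2 : Tendsto (fun z ↦ ((R n : ℂ))⁻¹ * φ n z) (cocompact ℂ ⊓ 𝓟 upperHalfPlaneSet)
        (𝓝 (Φ n (μ n))) :=
      (((hΦc n) (μ n) (hμmem n)).tendsto.comp hS').congr'
        (eventually_inf_principal.2 (Eventually.of_forall fun z hz ↦ (hkey n z hz).symm))
    exact tendsto_nhds_unique h2 h1
  have hΦζ : ∀ n, Φ n (ζ n) = ((R n : ℂ))⁻¹ * peanoPt (Δ n).a := fun n ↦ by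
    have := (hφ n).1.1
    rw [ConformalEquiv.HasBoundaryValue, Domain.toDobrushinDomain_pt_zero] at this
    exact hbv0 this
  have hΦμ : ∀ n, Φ n (μ n) = ((R n : ℂ))⁻¹ * peanoPt (Δ n).b := fun n ↦ by
    have := (hφ n).1.2
    rw [ConformalEquiv.HasBoundaryValueAtInfty, Domain.toDobrushinDomain_pt_one] at this
    exact hbvinf this
  -- the same for the limit map
  have hΦlζ : Φl ζl = D.toMarkedDomain.pt 0 := by
    have h1 : Tendsto φD (𝓝[upperHalfPlaneSet] 0) (𝓝 (D.toMarkedDomain.pt 0)) := hφD.1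
    have hS' : Tendsto Sl (𝓝[upperHalfPlaneSet] 0) (𝓝[closedBall 0 1] ζl) := by
      refine tendsto_nhdsWithin_iff.2 ⟨?_, ?_⟩
      · exact (tendsto_mul_moebius_nhdsWithin_zero hwlmem μl).congr'
          (eventually_nhdsWithin_of_forall fun z hz ↦ (hSlμ hz).symm)
      · exact eventually_nhdsWithin_of_forall fun z hz ↦ ball_subset_closedBall (Sl.mapsTo hz)
    have h2 : Tendsto φD (𝓝[upperHalfPlaneSet] 0) (𝓝 (Φl ζl)) :=
      ((hΦlc ζl hζlmem).tendsto.comp hS').congr'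
        (eventually_nhdsWithin_of_forall fun z hz ↦ (hkeyl z hz).symm)
    exact tendsto_nhds_unique h2 h1
  have hΦlμ : Φl μl = D.toMarkedDomain.pt 1 := by
    have h1 : Tendsto φD (cocompact ℂ ⊓ 𝓟 upperHalfPlaneSet) (𝓝 (D.toMarkedDomain.pt 1)) := hφD.2
    have hS' : Tendsto Sl (cocompact ℂ ⊓ 𝓟 upperHalfPlaneSet) (𝓝[closedBall 0 1] μl) := by
      refine tendsto_nhdsWithin_iff.2 ⟨?_, ?_⟩
      · exact (tendsto_mul_moebius_cocompact hwlmem μl).congr'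
          (eventually_inf_principal.2 (Eventually.of_forall fun z hz ↦ (hSlμ hz).symm))
      · exact eventually_inf_principal.2
          (Eventually.of_forall fun z hz ↦ ball_subset_closedBall (Sl.mapsTo hz))
    have h2 : Tendsto φD (cocompact ℂ ⊓ 𝓟 upperHalfPlaneSet) (𝓝 (Φl μl)) :=
      ((hΦlc μl hμlmem).tendsto.comp hS').congr'
        (eventually_inf_principal.2 (Eventually.of_forall fun z hz ↦ (hkeyl z hz).symm))
    exact tendsto_nhds_unique h2 h1
  -- `Rₙ⁻¹ aₙ → a`, `Rₙ⁻¹ bₙ → b`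
  have hscale : ∀ {q : ℕ → ℂ} {p : ℂ}, (∀ n, dist (q n) (R n * p) ≤ 12) →
      Tendsto (fun n ↦ ((R n : ℂ))⁻¹ * q n) atTop (𝓝 p) := by
    intro q p hq
    rw [Metric.tendsto_nhds]
    intro ε hε
    have h1 : Tendsto (fun n ↦ 12 / R n) atTop (𝓝 0) := tendsto_const_nhds.div_atTop hR
    filter_upwards [(tendsto_order.1 h1).2 ε hε] with n hn
    have e : p = ((R n : ℂ))⁻¹ * ((R n : ℂ) * p) := by
      rw [inv_mul_cancel_left₀ (by exact_mod_cast (hRpos n).ne')]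
    rw [e, hcR n, dist_ofReal_mul, abs_of_pos (inv_pos.2 (hRpos n))]
    calc (R n)⁻¹ * dist (q n) ((R n : ℂ) * p) ≤ (R n)⁻¹ * 12 :=
          mul_le_mul_of_nonneg_left (hq n) (inv_pos.2 (hRpos n)).le
      _ = 12 / R n := by ring
      _ < ε := hn
  have hca : Tendsto (fun n ↦ ((R n : ℂ))⁻¹ * peanoPt (Δ n).a) atTop (𝓝 (D.toMarkedDomain.pt 0)) :=
    hscale fun n ↦ (hΔ n).dist_peanoPt_a_le
  have hcb : Tendsto (fun n ↦ ((R n : ℂ))⁻¹ * peanoPt (Δ n).b) atTop (𝓝 (D.toMarkedDomain.pt 1)) :=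
    hscale fun n ↦ (hΔ n).dist_peanoPt_b_le
  -- hence `ζₙ → ζ`, `μₙ → μ` (injectivity of `Φ` on the closed disc)
  have hΦlinj : InjOn Φl (closedBall 0 1) := hΦlbij.injOn
  have hunif : ∀ {x : ℕ → ℂ}, (∀ n, x n ∈ closedBall (0 : ℂ) 1) →
      Tendsto (fun n ↦ dist (Φ n (x n)) (Φl (x n))) atTop (𝓝 0) := by
    intro x hx
    rw [Metric.tendsto_nhds]
    intro ε hε
    filter_upwards [Metric.tendstoUniformlyOn_iff.1 hrado ε hε] with n hn
    rw [Real.dist_eq, sub_zero, abs_of_nonneg dist_nonneg, dist_comm]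
    exact hn (x n) (hx n)
  have hζlim : Tendsto ζ atTop (𝓝 ζl) := by
    refine tendsto_of_injOn_of_tendsto_comp (isCompact_closedBall 0 1) hΦlc hΦlinj
      (Eventually.of_forall hζmem) hζlmem ?_
    rw [hΦlζ]
    have h1 : Tendsto (fun n ↦ Φ n (ζ n)) atTop (𝓝 (D.toMarkedDomain.pt 0)) :=
      hca.congr fun n ↦ (hΦζ n).symm
    exact h1.congr_dist (hunif hζmem)
  have hμlim : Tendsto μ atTop (𝓝 μl) := by
    refine tendsto_of_injOn_of_tendsto_comp (isCompact_closedBall 0 1) hΦlc hΦlinj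
      (Eventually.of_forall hμmem) hμlmem ?_
    rw [hΦlμ]
    have h1 : Tendsto (fun n ↦ Φ n (μ n)) atTop (𝓝 (D.toMarkedDomain.pt 1)) :=
      hcb.congr fun n ↦ (hΦμ n).symm
    exact h1.congr_dist (hunif hμmem)
  -- hence `wₙ → w` (`wₙ² = ζₙ/μₙ → ζ/μ = w²`, and `|wₙ - w| Im w ≤ |wₙ² - w²|`)
  have hμne : ∀ n, μ n ≠ 0 := fun n ↦ by rw [← norm_ne_zero_iff, hμ1 n]; exact one_ne_zero
  have hμlne : μl ≠ 0 := by rw [← norm_ne_zero_iff, hμl1]; exact one_ne_zero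
  have hwlim : Tendsto w atTop (𝓝 wl) := by
    have hsq : Tendsto (fun n ↦ w n ^ 2) atTop (𝓝 (wl ^ 2)) := by
      have h1 : Tendsto (fun n ↦ ζ n / μ n) atTop (𝓝 (ζl / μl)) := hζlim.div hμlim hμlne
      have e1 : ∀ n, ζ n / μ n = w n ^ 2 := fun n ↦ by
        rw [hζ]; simp only
        rw [mul_div_cancel_left₀ _ (hμne n), div_conj_eq_sq (hwnorm n)]
      have e2 : ζl / μl = wl ^ 2 := by
        rw [hζl, mul_div_cancel_left₀ _ hμlne, div_conj_eq_sq hwlnorm]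
      rw [← e2]
      exact h1.congr e1
    have hwlim' : 0 < wl.im := hwlmem
    rw [Metric.tendsto_nhds] at hsq ⊢
    intro ε hε
    filter_upwards [hsq (ε * wl.im) (by positivity)] with n hn
    have hsum : wl.im ≤ ‖w n + wl‖ := by
      calc wl.im ≤ (w n).im + wl.im := by linarith [(show 0 < (w n).im from hwmem n).le]
        _ = (w n + wl).im := by simp
        _ ≤ |(w n + wl).im| := le_abs_self _
        _ ≤ ‖w n + wl‖ := Complex.abs_im_le_norm _
    have hprod : ‖w n - wl‖ * ‖w n + wl‖ = dist (w n ^ 2) (wl ^ 2) := by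
      rw [← norm_mul, dist_eq_norm]; congr 1; ring
    rw [dist_eq_norm]
    by_contra hge
    rw [not_lt] at hge
    have : ε * wl.im ≤ ‖w n - wl‖ * ‖w n + wl‖ :=
      mul_le_mul hge hsum hwlim'.le (norm_nonneg _)
    linarith
  -- `Tₙ → T` uniformly on `ℍ`, and the conclusion
  have hT := tendstoUniformlyOn_mul_moebius hwlmem hwlim hμlim (fun n ↦ (hμ1 n).le)
  rw [Metric.tendstoUniformlyOn_iff]
  intro ε hε
  obtain ⟨δ, hδ, hδΦ⟩ := Metric.uniformContinuousOn_iff.1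
    ((isCompact_closedBall (0 : ℂ) 1).uniformContinuousOn_of_continuous hΦlc) (ε / 2) (half_pos hε)
  filter_upwards [Metric.tendstoUniformlyOn_iff.1 hrado (ε / 2) (half_pos hε),
    Metric.tendstoUniformlyOn_iff.1 hT δ hδ] with n hn1 hn2 z hz
  have hSz : S n z ∈ closedBall (0 : ℂ) 1 := ball_subset_closedBall ((S n).mapsTo hz)
  have hSlz : Sl z ∈ closedBall (0 : ℂ) 1 := ball_subset_closedBall (Sl.mapsTo hz)
  have hd : dist (Sl z) (S n z) < δ := by
    rw [hSlμ hz, hSμ n hz]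
    exact hn2 z hz
  rw [hkeyl z hz, hkey n z hz]
  calc dist (Φl (Sl z)) (Φ n (S n z))
      ≤ dist (Φl (Sl z)) (Φl (S n z)) + dist (Φl (S n z)) (Φ n (S n z)) := dist_triangle _ _ _
    _ < ε / 2 + ε / 2 := add_lt_add (hδΦ _ hSlz _ hSz hd) (hn1 _ hSz)
    _ = ε := by ring

/-- **[LSW04] p. 977, "`lim_{R → ∞} R⁻¹ φ_R⁻¹(z) = φ⁻¹(z)`, uniformly in `ℍ̄`", along any
approximating sequence `D^{Rₙ}`, `Rₙ → ∞`** (the hypothesis `hconv` of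
`USTPeano.drivingProcess_tendsto_of_thm44`): reduction to `tendstoUniformlyOn_inv_mul_of_forall`
by discarding the finitely many scales with `Rₙ |a - b| ≤ 22`. [cite: LawlerSchrammWerner2004, §4.3] -/
theorem tendstoUniformlyOn_inv_mul (hR : Tendsto R atTop atTop)
    (hΔ : ∀ n, IsApproximation D (R n) (Δ n))
    (φD : ConformalEquiv upperHalfPlaneSet D.toMarkedDomain.carrier)
    (hφD : D.toMarkedDomain.IsChordalUniformizing φD) (hφD1 : ‖φD.symm 0‖ = 1)
    (φ : ∀ n, ConformalEquiv upperHalfPlaneSet (Δ n).carrier) (hφ : ∀ n, (Δ n).IsLSWMap (φ n)) :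
    TendstoUniformlyOn (fun n z ↦ ((R n : ℂ))⁻¹ * φ n z) φD atTop upperHalfPlaneSet := by
  have hab : 0 < dist (D.toMarkedDomain.pt 0) (D.toMarkedDomain.pt 1) :=
    dist_pos.2 fun heq ↦ by simpa using D.toMarkedDomain.pt_injective heq
  obtain ⟨N₀, hN₀⟩ := eventually_atTop.1
    (hR.eventually_gt_atTop (22 / dist (D.toMarkedDomain.pt 0) (D.toMarkedDomain.pt 1)))
  have hRn : ∀ n, 22 < R (n + N₀) * dist (D.toMarkedDomain.pt 0) (D.toMarkedDomain.pt 1) :=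
    fun n ↦ by
    have := hN₀ (n + N₀) (Nat.le_add_left _ _)
    rwa [div_lt_iff₀ hab] at this
  have hshift := tendstoUniformlyOn_inv_mul_of_forall D (fun n ↦ R (n + N₀)) (fun n ↦ Δ (n + N₀))
    (hR.comp (tendsto_add_atTop_nat N₀)) (fun n ↦ hΔ (n + N₀)) hRn φD hφD hφD1
    (fun n ↦ φ (n + N₀)) (fun n ↦ hφ (n + N₀))
  rw [Metric.tendstoUniformlyOn_iff] at hshift ⊢
  intro ε hε
  have h1 := hshift ε hε
  have h2 : ∀ᶠ n in Filter.map (fun n ↦ n + N₀) atTop,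
      ∀ x ∈ upperHalfPlaneSet, dist (φD x) (((R n : ℂ))⁻¹ * φ n x) < ε :=
    Filter.eventually_map.2 h1
  rwa [Filter.map_add_atTop_eq_nat N₀] at h2

end Convergence

/-! ### The glue with Thm. 4.4 alone -/

/-- **[LSW04] p. 981: "Theorem 4.4 implies that the law of `W` converges weakly to the law of
`B(8t)`" — now from Thm. 4.4 as printed ALONE.** The named fact
`USTPeano.drivingProcess_tendsto` follows from `h44` = [LSW04] Thm. 4.4 in its printed coupling
shape (verbatim the hypothesis of `drivingProcess_tendsto_of_thm44`, see there for the rendering):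
the second input of that theorem, the convergence `R⁻¹ φ_R⁻¹ → φ⁻¹` of the normalised maps
([LSW04] p. 977, "Cor. 2.4 in [Pommerenke 1992]"), is `tendstoUniformlyOn_inv_mul` (Radó's
theorem, proved in the tree). What remains of `drivingProcess_tendsto` is exactly Thm. 4.4.
[cite: LawlerSchrammWerner2004, Thm. 4.4] -/
theorem drivingProcess_tendsto_of_thm44'
    (h44 : ∀ (ε₁ ε₂ ε₃ T : ℝ), 0 < ε₁ → 0 < ε₂ → 0 < ε₃ → 0 < T → ∃ r₁ : ℝ, ∀ (Δ : Domain),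
      (0 : ℂ) ∈ Δ.carrier → ball (0 : ℂ) r₁ ⊆ Δ.carrier →
      ∀ (φ : ConformalEquiv upperHalfPlaneSet Δ.carrier), Δ.IsLSWMap φ →
        ε₁ * π ≤ arg (φ.symm 0) → arg (φ.symm 0) ≤ (1 - ε₁) * π →
        ∀ (Γ : PeanoPath Δ → C(ℝ≥0, ℂ)) (W : PeanoPath Δ → C(ℝ≥0, ℝ)),
          (∀ γ, IsCapacityImage Δ φ γ (Γ γ) (W γ)) →
          ∃ ρ : Measure (C(ℝ≥0, ℝ) × C(ℝ≥0, ℝ)), ρ.fst = (ustLaw Δ).map W ∧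
            ρ.snd = Process.preWienerMeasure.map brownianTimeEight ∧
            ρ {p | ∃ t : ℝ≥0, (t : ℝ) ≤ T ∧ ε₂ < dist (p.1 t) (p.2 t)} < ENNReal.ofReal ε₃) :
    drivingProcess_tendsto :=
  drivingProcess_tendsto_of_thm44 h44 fun D R Δ hR hΔ φD hφD hφD1 φ hφ ↦
    tendstoUniformlyOn_inv_mul D R Δ hR hΔ φD hφD hφD1 φ hφ

end USTPeano
end Literature.Probability.RandomPlanarGeometry
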